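import Summits.ValiantsHypothesis.ValiantsHypothesis.Theorems.LacunarySymmetroidMatrixDescartesCensusCUSoundModel

/-!
# `MatrixDescartes` census — soundness of the chamber-uniform checker, part 3b: the Newton cone as concavity, the Abel–transport inequality

HONEST FRAMING.  Object-search cell `pub-symmetroid`; door-A item `DoorA26 = PosRootLawAt 2 6 19`
(stmt-ValiantsHypothesis-19979; OPEN, typed, never asserted).  Continuation of `…CensusCUSoundModel`: the Newton-cone rows of the
model read as CONCAVITY of `t ↦ (E_t, log x_t + log W_t)` (`CU.conc_of_model`, `W_t = ∏_u |E_t − E_u|`), the decomposition of the gap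
weights `log W_t` into pair logarithms (`CU.sum_log_Wn_eq_pairs`), and the resulting ABEL–TRANSPORT inequality `CU.vdot_le_pairs`:
`Σ b_t log x_t ≤ Σ_{s<t} −(b_s + b_t) · log (E_t − E_s)` for every Abel-admissible `b`.  Nothing here bears on `V = 19`, on `DoorA26`
itself (OPEN), on `MatrixDescartes` (stmt-ValiantsHypothesis-18050) or on `VP ≠ VNP`.

[folklore] Certificate-checker soundness; elementary.
-/

-- the D-0017 layout repeats a namespace component (single-conjunct summit); the `dupNamespace` linter flags it; name mandated.
set_option linter.dupNamespace false

namespace Summit.ValiantsHypothesis.ValiantsHypothesis.Theorems.LacunarySymmetroidMatrixDescartes.Census.CU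

open V20 (Atom Term PolySpec allAtoms posOf qA cA termNeg posTerms posl negAt fval Row RowSpec buildRow lprod pval tval sgnR
  Epos sums dist1 ordOK psum)
open Finset

variable {dl : List ℕ} {ord : List Atom} {s : Bool} {x : ℕ → ℝ} {v : Atom → ℝ}

/-! ## The Newton cone as concavity -/

/-- The gap-product weight `W_t = ∏_{u<21} dist1(E_t, E_u)` (a positive natural number). [folklore] -/
def Wn (dl : List ℕ) (ord : List Atom) (t : ℕ) : ℕ := ((sums dl ord).map (dist1 (Epos dl ord t))).prod

/-- The concave sequence `A_t = ℓ_t + log W_t`. [folklore] -/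
noncomputable def Aseq (dl : List ℕ) (ord : List Atom) (x : ℕ → ℝ) (t : ℕ) : ℝ := ell x t + Real.log (Wn dl ord t : ℝ)

/-- `W_t > 0`. [folklore] -/
theorem Wn_pos (dl : List ℕ) (ord : List Atom) (t : ℕ) : 0 < Wn dl ord t := by
  unfold Wn
  apply List.prod_pos
  intro a ha
  rw [List.mem_map] at ha
  obtain ⟨u, -, rfl⟩ := ha
  exact V20.dist1_pos _ _

/-- **Concavity**: the Newton-cone row `C25(t)` of the model says the slope of `(E, A)` does not increase at `t`. [folklore] -/
theorem conc_of_model (M : V20.Model dl ord s x v) {t : ℕ} (h1 : 1 ≤ t) (h19 : t ≤ 19) :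
    ((Epos dl ord (t + 1) : ℝ) - Epos dl ord t) * (Aseq dl ord x (t - 1) - Aseq dl ord x t)
      + ((Epos dl ord t : ℝ) - Epos dl ord (t - 1)) * (Aseq dl ord x (t + 1) - Aseq dl ord x t) ≤ 0 := by
  have h := M.hord
  have hx := M.xpos
  have hrow := M.c25 t h1 h19
  have hpq : Epos dl ord (t - 1) < Epos dl ord t := V20.Epos_lt h (by omega) (by omega)
  have hqr : Epos dl ord t < Epos dl ord (t + 1) := V20.Epos_lt h (by omega) (by omega)
  generalize hp : Epos dl ord (t - 1) = p at hrow hpq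
  generalize hq : Epos dl ord t = q at hrow hpq hqr
  generalize hr : Epos dl ord (t + 1) = r at hrow hqr
  have eL : (V20.rowC25 (sums dl ord) t).L = List.replicate (r - q) (t - 1) ++ List.replicate (q - p) (t + 1) := by
    simp only [V20.rowC25, V20.sums_getD h (show t - 1 < 21 by omega), V20.sums_getD h (show t < 21 by omega),
      V20.sums_getD h (show t + 1 < 21 by omega), hp, hq, hr]
  have eR : (V20.rowC25 (sums dl ord) t).R = List.replicate (q - p + (r - q)) t := by
    simp only [V20.rowC25, V20.sums_getD h (show t - 1 < 21 by omega), V20.sums_getD h (show t < 21 by omega),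
      V20.sums_getD h (show t + 1 < 21 by omega), hp, hq, hr]
  have eBnum : fval (V20.rowC25 (sums dl ord) t).Bnum = ((sums dl ord).map (dist1 q)).prod ^ (q - p + (r - q)) := by
    simp only [V20.rowC25, V20.sums_getD h (show t - 1 < 21 by omega), V20.sums_getD h (show t < 21 by omega),
      V20.sums_getD h (show t + 1 < 21 by omega), hp, hq, hr]
    exact V20.fval_map_const _ _ _
  have eBden : fval (V20.rowC25 (sums dl ord) t).Bden
      = ((sums dl ord).map (dist1 p)).prod ^ (r - q) * ((sums dl ord).map (dist1 r)).prod ^ (q - p) := by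
    simp only [V20.rowC25, V20.sums_getD h (show t - 1 < 21 by omega), V20.sums_getD h (show t < 21 by omega),
      V20.sums_getD h (show t + 1 < 21 by omega), hp, hq, hr]
    rw [V20.fval_append, V20.fval_map_const, V20.fval_map_const]
  rw [eL, eR, eBnum, eBden, V20.lprod_append, V20.lprod_replicate, V20.lprod_replicate, V20.lprod_replicate] at hrow
  -- the three weights
  have hWp : (0 : ℝ) < (((sums dl ord).map (dist1 p)).prod : ℕ) := by
    have := Wn_pos dl ord (t - 1); rw [Wn, hp] at this; exact_mod_cast this
  have hWq : (0 : ℝ) < (((sums dl ord).map (dist1 q)).prod : ℕ) := by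
    have := Wn_pos dl ord t; rw [Wn, hq] at this; exact_mod_cast this
  have hWr : (0 : ℝ) < (((sums dl ord).map (dist1 r)).prod : ℕ) := by
    have := Wn_pos dl ord (t + 1); rw [Wn, hr] at this; exact_mod_cast this
  have hA1 : Aseq dl ord x (t - 1) = Real.log (x (t - 1)) + Real.log ((((sums dl ord).map (dist1 p)).prod : ℕ) : ℝ) := by
    rw [Aseq, ell, Wn, hp]
  have hA2 : Aseq dl ord x t = Real.log (x t) + Real.log ((((sums dl ord).map (dist1 q)).prod : ℕ) : ℝ) := by
    rw [Aseq, ell, Wn, hq]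
  have hA3 : Aseq dl ord x (t + 1) = Real.log (x (t + 1)) + Real.log ((((sums dl ord).map (dist1 r)).prod : ℕ) : ℝ) := by
    rw [Aseq, ell, Wn, hr]
  -- logarithms of the row
  simp only [Nat.cast_mul, Nat.cast_pow] at hrow
  have hxa := hx (t - 1)
  have hxm := hx t
  have hxc := hx (t + 1)
  have hlog := Real.log_le_log (by positivity) hrow
  rw [Real.log_mul (by positivity) (by positivity), Real.log_mul (by positivity) (by positivity),
    Real.log_mul (by positivity) (by positivity), Real.log_mul (by positivity) (by positivity),
    Real.log_pow, Real.log_pow, Real.log_pow, Real.log_pow, Real.log_pow, Real.log_pow] at hlog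
  have e1 : (((r - q : ℕ)) : ℝ) = (r : ℝ) - q := by rw [Nat.cast_sub hqr.le]
  have e2 : (((q - p : ℕ)) : ℝ) = (q : ℝ) - p := by rw [Nat.cast_sub hpq.le]
  have e3 : (((q - p + (r - q) : ℕ)) : ℝ) = (r : ℝ) - p := by
    rw [Nat.cast_add, Nat.cast_sub hqr.le, Nat.cast_sub hpq.le]; ring
  rw [e1, e2, e3] at hlog
  rw [hA1, hA2, hA3]
  linarith [hlog]

/-! ## The gap weights as pair logarithms -/

/-- A `List.range` product is a `Finset.range` product. [folklore] -/
theorem prod_map_range (f : ℕ → ℝ) : ∀ n : ℕ, ((List.range n).map f).prod = ∏ i ∈ range n, f i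
  | 0 => by simp
  | n + 1 => by rw [List.range_succ, List.map_append, List.prod_append, prod_map_range f n, prod_range_succ]; simp

/-- The sums list is the list of the 21 pair sums. [folklore] -/
theorem sums_eq_map (h : ordOK dl ord = true) : sums dl ord = (List.range 21).map (Epos dl ord) := by
  have hlen : (sums dl ord).length = 21 := by rw [sums, List.length_map, (V20.ordOK_spec h).2.1]
  apply List.ext_getElem (by simp [hlen])
  intro i hi _
  have hi' : i < 21 := by rw [hlen] at hi; exact hi
  have := V20.sums_getD h hi'
  rw [List.getD_eq_getElem _ _ hi] at this
  simp [this]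

/-- `log W_t = Σ_{u<21} log dist1(E_t, E_u)`. [folklore] -/
theorem log_Wn (h : ordOK dl ord = true) (t : ℕ) :
    Real.log (Wn dl ord t : ℝ) = ∑ u ∈ range 21, Real.log (dist1 (Epos dl ord t) (Epos dl ord u) : ℝ) := by
  rw [Wn, sums_eq_map h, List.map_map, Nat.cast_list_prod, List.map_map]
  have : ((List.range 21).map (Nat.cast ∘ (dist1 (Epos dl ord t) ∘ Epos dl ord)) : List ℝ).prod
      = ∏ u ∈ range 21, (dist1 (Epos dl ord t) (Epos dl ord u) : ℝ) := by
    rw [← prod_map_range]; rfl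
  rw [this, Real.log_prod]
  intro u _
  exact_mod_cast (V20.dist1_pos _ _).ne'

/-- `dist1` below the diagonal. [folklore] -/
theorem dist1_of_lt {a b : ℕ} (hab : b < a) : dist1 a b = a - b := by
  unfold dist1; rw [if_neg (by omega), if_neg (by omega)]

/-- `dist1` above the diagonal. [folklore] -/
theorem dist1_of_gt {a b : ℕ} (hab : a < b) : dist1 a b = b - a := by
  unfold dist1; rw [if_neg (by omega), if_pos hab.le]

/-- **Pair decomposition of the gap weights**: `Σ_t b_t log W_t = Σ_{s<t<21} (b_s + b_t) log (E_t − E_s)`. [folklore] -/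
theorem sum_log_Wn_eq_pairs (h : ordOK dl ord = true) (b : ℕ → ℝ) :
    ∑ t ∈ range 21, b t * Real.log (Wn dl ord t : ℝ)
      = ∑ t ∈ range 21, ∑ s ∈ range t, (b s + b t) * Real.log ((Epos dl ord t : ℝ) - Epos dl ord s) := by
  -- the symmetric kernel
  set L : ℕ → ℕ → ℝ := fun s t => Real.log ((Epos dl ord t : ℝ) - Epos dl ord s) with hL
  have hdiag : ∀ t, t < 21 → Real.log (Wn dl ord t : ℝ) = ∑ u ∈ range t, L u t + ∑ u ∈ Ico (t + 1) 21, L t u := by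
    intro t ht
    rw [log_Wn h t, ← Finset.sum_range_add_sum_Ico _ (show t ≤ 21 by omega), Finset.sum_eq_sum_Ico_succ_bot (by omega)]
    have h0 : Real.log (dist1 (Epos dl ord t) (Epos dl ord t) : ℝ) = 0 := by simp [dist1]
    rw [h0, zero_add]
    congr 1
    · refine sum_congr rfl fun u hu => ?_
      have hut : Epos dl ord u < Epos dl ord t := V20.Epos_lt h (mem_range.1 hu) ht
      rw [dist1_of_lt hut, Nat.cast_sub hut.le]
    · refine sum_congr rfl fun u hu => ?_
      rw [mem_Ico] at hu
      have htu : Epos dl ord t < Epos dl ord u := V20.Epos_lt h (by omega) hu.2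
      rw [dist1_of_gt htu, Nat.cast_sub htu.le]
  have step1 : ∑ t ∈ range 21, b t * Real.log (Wn dl ord t : ℝ)
      = ∑ t ∈ range 21, ∑ u ∈ range t, b t * L u t + ∑ t ∈ range 21, ∑ u ∈ Ico (t + 1) 21, b t * L t u := by
    rw [← sum_add_distrib]
    refine sum_congr rfl fun t ht => ?_
    rw [hdiag t (mem_range.1 ht), mul_add, mul_sum, mul_sum]
  have step2 : ∑ t ∈ range 21, ∑ u ∈ Ico (t + 1) 21, b t * L t u = ∑ u ∈ range 21, ∑ t ∈ range u, b t * L t u :=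
    Finset.sum_comm' (fun t u => by simp only [mem_range, mem_Ico]; omega)
  rw [step1, step2, ← sum_add_distrib]
  refine sum_congr rfl fun t _ => ?_
  rw [← sum_add_distrib]
  exact sum_congr rfl fun u _ => by ring

/-! ## The Abel–transport inequality -/

/-- **`Σ b_t ℓ_t ≤ Σ_{s<t} −(b_s + b_t) log (E_t − E_s)`** for every Abel-admissible `b` (the conditions as `abelOK` certifies them,
evaluated at the support `d` of the model; `E_t − E_s` = value of the pair form). [folklore] -/
theorem vdot_le_pairs (d : Fin 6 → ℕ) (hordA : ordAtomsOK ord = true) (M : V20.Model (dlist d) ord s x v)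
    {b : List ℤ} (hlen : b.length = 21) (hsum : (∑ t ∈ range 21, (b.getD t 0 : ℝ)) = 0)
    (hC : ∀ j, 1 ≤ j → j ≤ 19 →
      ∑ i ∈ range j, (∑ t ∈ Ico (i + 1) 21, (b.getD t 0 : ℝ)) *
        (((Eform ord (i + 1)).ev d : ℝ) - ((Eform ord i).ev d : ℝ)) ≤ 0)
    (hC20 : ∑ i ∈ range 20, (∑ t ∈ Ico (i + 1) 21, (b.getD t 0 : ℝ)) *
        (((Eform ord (i + 1)).ev d : ℝ) - ((Eform ord i).ev d : ℝ)) = 0) :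
    vdot b (ell x) ≤ ∑ t ∈ range 21, ∑ s ∈ range t,
      -((b.getD s 0 : ℝ) + b.getD t 0) * Real.log ((pairForm ord (s, t)).ev d : ℝ) := by
  have h := M.hord
  -- the real pair sums
  set E : ℕ → ℝ := fun t => ((Eform ord t).ev d : ℝ) with hE
  have hEpos : ∀ t, t < 21 → (Epos (dlist d) ord t : ℝ) = E t := by
    intro t ht
    have := Epos_eq_ev d hordA ht
    simp only [hE]; exact_mod_cast this
  have hElt : ∀ i, i < 20 → E i < E (i + 1) := by
    intro i hi
    rw [← hEpos i (by omega), ← hEpos (i + 1) (by omega)]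
    exact_mod_cast V20.Epos_lt h (Nat.lt_succ_self i) (by omega)
  -- Abel on `A`
  have hab := abel_nonpos (Aseq (dlist d) ord x) E (fun t => (b.getD t 0 : ℝ)) hElt
    (fun t h1 h19 => by
      have := conc_of_model M h1 h19
      rwa [hEpos (t + 1) (by omega), hEpos t (by omega), hEpos (t - 1) (by omega)] at this)
    hsum hC hC20
  -- split `A = ℓ + log W`
  have hsplit : ∑ t ∈ range 21, (b.getD t 0 : ℝ) * Aseq (dlist d) ord x t
      = vdot b (ell x) + ∑ t ∈ range 21, (b.getD t 0 : ℝ) * Real.log (Wn (dlist d) ord t : ℝ) := by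
    rw [vdot_eq_sum, hlen, ← sum_add_distrib]
    exact sum_congr rfl fun t _ => by rw [Aseq]; ring
  rw [hsplit, sum_log_Wn_eq_pairs h] at hab
  have hpairs : ∑ t ∈ range 21, ∑ s ∈ range t, ((b.getD s 0 : ℝ) + b.getD t 0) *
      Real.log ((Epos (dlist d) ord t : ℝ) - Epos (dlist d) ord s)
      = ∑ t ∈ range 21, ∑ s ∈ range t, ((b.getD s 0 : ℝ) + b.getD t 0) * Real.log ((pairForm ord (s, t)).ev d : ℝ) := by
    refine sum_congr rfl fun t ht => sum_congr rfl fun u hu => ?_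
    have ht' := mem_range.1 ht
    have hu' : u < 21 := lt_trans (mem_range.1 hu) ht'
    rw [hEpos t ht', hEpos u hu', ev_pairForm]
    simp [hE]
  rw [hpairs] at hab
  have : ∑ t ∈ range 21, ∑ s ∈ range t, -((b.getD s 0 : ℝ) + b.getD t 0) * Real.log ((pairForm ord (s, t)).ev d : ℝ)
      = -∑ t ∈ range 21, ∑ s ∈ range t, ((b.getD s 0 : ℝ) + b.getD t 0) * Real.log ((pairForm ord (s, t)).ev d : ℝ) := by
    rw [← sum_neg_distrib]
    refine sum_congr rfl fun t _ => ?_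
    rw [← sum_neg_distrib]
    exact sum_congr rfl fun u _ => by ring
  rw [this]
  linarith

end Summit.ValiantsHypothesis.ValiantsHypothesis.Theorems.LacunarySymmetroidMatrixDescartes.Census.CU
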